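import Literature.Analysis.FluidPDE.KwonHarmonicPartKernel
import Literature.Analysis.FluidPDE.KwonDecompositionMomentum
import Literature.Analysis.FluidPDE.DistributionalToWeak
import HarnessLib

/-!
# Kwon's drift: the time derivative in the sense of distributions (first step of (T1))

Analysis/FluidPDE proof file (theorems only) on the discharge path of the named fact
`Literature.Analysis.FluidPDE.kwon2023_velocity_epsilon_regularity`
(`PressureFreeEpsilonRegularity.lean`; H. Kwon, J. Differential Equations (2023) =
arXiv:2104.03160, Thm. 1.4). In the proof of Lemma 2.5 (p. 8–9) the drift `h = H u` of the
decomposition `u = v + h` (Remark 2.3 (2.3)) inherits its time regularity from the Navier–Stokes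
equations: `h(t,x) = ∫ K(x,y) u(t,y) dy` with a smooth kernel supported in the shell
`5/4 ≤ |y| ≤ 7/4` (`KwonHarmonicPartKernel`), so `∂ₜh` is obtained by testing the momentum equation
with the `y`-kernel. This file types exactly that first step:

* `Kwon2023.inner_harmonicPartIntegrand_eq` — the pointwise adjoint of the kernel,
  `⟪K(x,y) w, c⟫ = ⟪w, η_{x,c}(y)⟫` with `η_{x,c}(y) = ⟪∇k(x − y), c⟫ ∇φ(y) − (c × ∇k(x − y)) × ∇φ(y)`;
* `Kwon2023.inner_harmonicPart_eq_integral` — `⟪h(x), c⟫ = ∫ ⟪w(y), η_{x,c}(y)⟫ dy`;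
* `Kwon2023.isSpaceTimeTestOn_time_smul_adjointField` — `χ(s) η_{x,c}(y)` is a space–time test
  field on `Q₂(0)` for `χ ∈ C_c^∞((−4,0))`;
* `Kwon2023.ns_tested_time_smul_adjointField` — the momentum equation of a distributional
  solution `(u, p)` on `Q₂(0)` tested with `χ(s) η_{x,c}(y)`:
  `∫∫_{Q₂} (χ'⟪u, η⟫ + χ(⟪u,(u·∇)η⟫ + ⟪u,Δη⟫ + p div η)) = 0`, i.e. the weak form of
  `∂ₜ⟪h(·,x), c⟫ = ∫ (⟪u ⊗ u, ∇η⟫ + ⟪u, Δη⟫ + p div η) dy` in `𝒟′(−4,0)`.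

This is the input "(T1) time regularity of `h`" of the local energy step of Lemma 2.5 (design memo
`kits/A4-R1b-localEnergy-design-ser-a-g8.md`). No NS-regularity statement is touched.

## Mathlib / tree search

Tree (reused): `harmonicPart_eq_integral` (`KwonHarmonicPartKernel`), `scalarDensity`,
`vectorDensity`, `annularKernel`, `kwonCutoff`, `gradient_kwonCutoff_eq_zero_of_gt`,
`exists_bound_gradient_annularKernel`, `continuous_uncurry_cross`, `crossCLM`
(`KwonHarmonicPart`, `KwonLocalLerayDuality`, `VectorCalculus`); `contDiff_gradient_of_contDiff_top`
(`ClassicalLerayProjection`); `IsDistributionalNSSolutionOn`, `IsSpaceTimeTestOn`, `timeDeriv`,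
`convect`, `parabolicCylinder(Opens)` (`WeakSolution`, `SuitableWeak`); `laplacian_fun_const_smul`,
`divergence_fun_const_smul` (`DistributionalToWeak`). Mathlib: `integral_inner`,
`deriv_smul_const`, `fderiv_fun_const_smul`, `setIntegral_congr_fun`, `cross_apply`.

## References

* H. Kwon, *The role of the pressure in the regularity theory for the Navier–Stokes equations*,
  J. Differential Equations 357 (2023) = arXiv:2104.03160: Remark 2.3 (2.3) and Lemma 2.5 (proof,
  p. 8–9). [Kwon2023RolePressure]
-/

noncomputable section

open MeasureTheory Set Function Filter Topology TopologicalSpace Metric InnerProductSpace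
  ContinuousLinearMap
open scoped NNReal ENNReal RealInnerProductSpace Convolution ContDiff Laplacian

namespace Literature.Analysis.FluidPDE

namespace Kwon2023

variable {u W : ℝ → EuclideanSpace ℝ (Fin 3) → EuclideanSpace ℝ (Fin 3)} {p : ℝ → EuclideanSpace ℝ (Fin 3) → ℝ}

/-! ### The adjoint kernel field `η_{x,c}(y)` -/

/-- **Pointwise adjoint of the harmonic-part kernel**: for the kernel
`K(x,y) w = ⟪w, g⟫ a − a × (g × w)` (`a = ∇k(x − y)`, `g = ∇φ(y)`) one has
`⟪K(x,y) w, c⟫ = ⟪w, ⟪a, c⟫ g − (c × a) × g⟫`. [cite: Kwon2023RolePressure, Remark 2.3 (2.3)] -/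
theorem inner_harmonicPartIntegrand_eq (w a g c : EuclideanSpace ℝ (Fin 3)) :
    ⟪⟪w, g⟫ • a - cross a (cross g w), c⟫ = ⟪w, ⟪a, c⟫ • g - cross (cross c a) g⟫ := by
  simp only [cross, PiLp.inner_apply, RCLike.inner_apply, conj_trivial, Fin.sum_univ_three,
    cross_apply, Matrix.cons_val_zero, Matrix.cons_val_one, Matrix.cons_val_two,
    Matrix.head_cons, Matrix.tail_cons, PiLp.sub_apply, PiLp.smul_apply, smul_eq_mul,
    WithLp.ofLp_toLp]
  ring

/-- The adjoint field `y ↦ ⟪∇k(x − y), c⟫ ∇φ(y) − (c × ∇k(x − y)) × ∇φ(y)` is smooth. [folklore] -/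
private theorem contDiff_adjointField (x c : EuclideanSpace ℝ (Fin 3)) :
    ContDiff ℝ ∞ fun y : EuclideanSpace ℝ (Fin 3) =>
      ⟪gradient annularKernel (x - y), c⟫ • gradient kwonCutoff y -
        cross (cross c (gradient annularKernel (x - y))) (gradient kwonCutoff y) := by
  have ha : ContDiff ℝ ∞ fun y : EuclideanSpace ℝ (Fin 3) => gradient annularKernel (x - y) :=
    (contDiff_gradient_of_contDiff_top contDiff_annularKernel).comp (contDiff_const.sub contDiff_id)
  have hg : ContDiff ℝ ∞ (gradient kwonCutoff) := contDiff_gradient_of_contDiff_top contDiff_kwonCutoff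
  have h1 : ContDiff ℝ ∞ fun y : EuclideanSpace ℝ (Fin 3) => cross c (gradient annularKernel (x - y)) := by
    have e : (fun y : EuclideanSpace ℝ (Fin 3) => cross c (gradient annularKernel (x - y))) =
        fun y => crossCLM c (gradient annularKernel (x - y)) := by
      funext y; rw [crossCLM_apply]
    rw [e]; exact (crossCLM c).contDiff.comp ha
  have h2 : ContDiff ℝ ∞ fun y : EuclideanSpace ℝ (Fin 3) =>
      cross (cross c (gradient annularKernel (x - y))) (gradient kwonCutoff y) := by
    have e : (fun y : EuclideanSpace ℝ (Fin 3) =>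
        cross (cross c (gradient annularKernel (x - y))) (gradient kwonCutoff y)) =
        fun y => crossCLM (cross c (gradient annularKernel (x - y))) (gradient kwonCutoff y) := by
      funext y; rw [crossCLM_apply]
    rw [e]; exact crossCLM.isBoundedBilinearMap.contDiff.comp (h1.prodMk hg)
  exact ((ha.inner ℝ contDiff_const).smul hg).sub h2

/-- The adjoint field vanishes off `|y| ≤ 7/4` (`∇φ = 0` there). [folklore] -/
private theorem adjointField_eq_zero_of_gt {x c y : EuclideanSpace ℝ (Fin 3)} (hy : 7 / 4 < ‖y‖) :
    ⟪gradient annularKernel (x - y), c⟫ • gradient kwonCutoff y -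
      cross (cross c (gradient annularKernel (x - y))) (gradient kwonCutoff y) = 0 := by
  rw [gradient_kwonCutoff_eq_zero_of_gt hy, smul_zero, ← crossCLM_apply, map_zero, sub_zero]

/-! ### The harmonic part paired with a vector -/

/-- The kernel integrand is integrable. [folklore] -/
private theorem integrable_harmonicPartIntegrand {w : EuclideanSpace ℝ (Fin 3) → EuclideanSpace ℝ (Fin 3)}
    (hw : IntegrableOn w (ball (0 : EuclideanSpace ℝ (Fin 3)) 2)) (x : EuclideanSpace ℝ (Fin 3)) :
    Integrable fun y => scalarDensity w y • gradient annularKernel (x - y) -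
      cross (gradient annularKernel (x - y)) (vectorDensity w y) := by
  obtain ⟨K, hK0, hK⟩ := exists_bound_gradient_annularKernel
  have hs := integrable_scalarDensity hw
  have hv := integrable_vectorDensity hw
  have hgk : Continuous (gradient annularKernel) :=
    FluidPDE.continuous_gradient_of_contDiff (contDiff_annularKernel (n := 1))
  have hgx : Continuous fun y : EuclideanSpace ℝ (Fin 3) => gradient annularKernel (x - y) :=
    hgk.comp (continuous_const.sub continuous_id)
  refine Integrable.sub ?_ ?_
  · refine (hs.norm.mul_const K).mono' (hs.aestronglyMeasurable.smul hgx.aestronglyMeasurable)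
      (Eventually.of_forall fun y => ?_)
    rw [norm_smul]
    exact mul_le_mul_of_nonneg_left (hK _) (norm_nonneg _)
  · have hm : AEStronglyMeasurable (fun y => cross (gradient annularKernel (x - y)) (vectorDensity w y)) volume :=
      continuous_uncurry_cross.comp_aestronglyMeasurable₂ hgx.aestronglyMeasurable hv.aestronglyMeasurable
    refine ((hv.norm.const_mul (‖crossCLM‖ * K))).mono' hm (Eventually.of_forall fun y => ?_)
    rw [← crossCLM_apply]
    calc ‖crossCLM (gradient annularKernel (x - y)) (vectorDensity w y)‖
        ≤ ‖crossCLM‖ * ‖gradient annularKernel (x - y)‖ * ‖vectorDensity w y‖ := le_opNorm₂ _ _ _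
      _ ≤ ‖crossCLM‖ * K * ‖vectorDensity w y‖ := by
          gcongr
          exact hK _

/-- **The harmonic part paired with a vector is the velocity paired with the adjoint field**:
`⟪h(x), c⟫ = ∫ ⟪w(y), η_{x,c}(y)⟫ dy`, `η_{x,c}(y) = ⟪∇k(x − y), c⟫ ∇φ(y) − (c × ∇k(x − y)) × ∇φ(y)`
— `h = H w` is an integral operator with a smooth kernel supported in the shell (Remark 2.3).
[cite: Kwon2023RolePressure, Remark 2.3 (2.3)] -/
theorem inner_harmonicPart_eq_integral {w : EuclideanSpace ℝ (Fin 3) → EuclideanSpace ℝ (Fin 3)}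
    (hw : IntegrableOn w (ball (0 : EuclideanSpace ℝ (Fin 3)) 2)) (x c : EuclideanSpace ℝ (Fin 3)) :
    ⟪harmonicPart w x, c⟫ = ∫ y, ⟪w y, ⟪gradient annularKernel (x - y), c⟫ • gradient kwonCutoff y -
      cross (cross c (gradient annularKernel (x - y))) (gradient kwonCutoff y)⟫ := by
  rw [harmonicPart_eq_integral hw x, real_inner_comm, ← integral_inner (integrable_harmonicPartIntegrand hw x) c]
  refine integral_congr_ae (Eventually.of_forall fun y => ?_)
  dsimp only
  rw [real_inner_comm, scalarDensity, vectorDensity, inner_harmonicPartIntegrand_eq]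

/-! ### The test field `χ(s) η_{x,c}(y)` on `Q₂(0)` -/

/-- `Q₂(0) = (−4, 0) × B₂`. [folklore] -/
private theorem parabolicCylinder_two_zero :
    parabolicCylinder 2 (0 : ℝ × EuclideanSpace ℝ (Fin 3)) =
      Ioo (-4 : ℝ) 0 ×ˢ ball (0 : EuclideanSpace ℝ (Fin 3)) 2 := by
  rw [parabolicCylinder]
  norm_num

/-- **The tensor test field `Ψ(s,y) = χ(s) η_{x,c}(y)` is a space–time test field on `Q₂(0)`**
for `χ ∈ C_c^∞((−4,0))` (the adjoint field is smooth and supported in `|y| ≤ 7/4 ⊂ B₂`).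
[cite: Kwon2023RolePressure, Lemma 2.5 (proof, p. 8) with Remark 2.3] -/
theorem isSpaceTimeTestOn_time_smul_adjointField {χ : ℝ → ℝ} (hχ : ContDiff ℝ ∞ χ)
    (hχc : HasCompactSupport χ) (hχI : tsupport χ ⊆ Ioo (-4 : ℝ) 0) (x c : EuclideanSpace ℝ (Fin 3)) :
    IsSpaceTimeTestOn (parabolicCylinderOpens 2 (0 : ℝ × EuclideanSpace ℝ (Fin 3)))
      (fun s y => χ s • (⟪gradient annularKernel (x - y), c⟫ • gradient kwonCutoff y -
        cross (cross c (gradient annularKernel (x - y))) (gradient kwonCutoff y))) := by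
  have hη := contDiff_adjointField x c
  have hts : tsupport (uncurry fun s y => χ s • (⟪gradient annularKernel (x - y), c⟫ • gradient kwonCutoff y -
      cross (cross c (gradient annularKernel (x - y))) (gradient kwonCutoff y))) ⊆
      tsupport χ ×ˢ closedBall (0 : EuclideanSpace ℝ (Fin 3)) (7 / 4) := by
    refine closure_minimal (fun z hz => ?_) ((isClosed_tsupport χ).prod isClosed_closedBall)
    by_contra h
    apply hz
    rcases not_and_or.1 (fun h' => h (mem_prod.2 h')) with h1 | h1
    · simp only [uncurry, image_eq_zero_of_notMem_tsupport h1, zero_smul]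
    · have hy : 7 / 4 < ‖z.2‖ := by
        rw [mem_closedBall_zero_iff, not_le] at h1; exact h1
      simp only [uncurry, adjointField_eq_zero_of_gt hy, smul_zero]
  refine ⟨(hχ.comp contDiff_fst).smul (hη.comp contDiff_snd), ?_, ?_⟩
  · exact IsCompact.of_isClosed_subset (hχc.prod (isCompact_closedBall 0 (7 / 4))) (isClosed_tsupport _) hts
  · refine hts.trans ?_
    rw [coe_parabolicCylinderOpens, parabolicCylinder_two_zero]
    exact prod_mono hχI (closedBall_subset_ball (by norm_num))

/-! ### The Navier–Stokes equations tested with `χ(s) η_{x,c}(y)` -/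

/-- **The momentum equation of `u` tested with `Ψ = χ(s) η_{x,c}(y)`** (distributional solution
on `Q₂(0)`, `ν = 1`, `f = 0`):
`∫∫_{Q₂} (χ'(s)⟪u, η⟫ + χ(s)(⟪u,(u·∇)η⟫ + ⟪u, Δη⟫ + p div η)) = 0`.
Combined with `inner_harmonicPart_eq_integral` (`⟪h(s,x), c⟫ = ∫⟪u(s,·), η⟫`) this is the weak
form of the time derivative of Kwon's drift `h = H u`: `∂ₜ⟪h(·,x),c⟫ = ∫(⟪u⊗u,∇η⟫ + ⟪u,Δη⟫ + p div η)`
in `𝒟′(−4,0)` — the time-regularity input of the local energy step of Lemma 2.5.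
[cite: Kwon2023RolePressure, Lemma 2.5 (proof, p. 8–9) with Remark 2.3] -/
theorem ns_tested_time_smul_adjointField
    (hu : IsDistributionalNSSolutionOn (parabolicCylinderOpens 2 (0 : ℝ × EuclideanSpace ℝ (Fin 3))) 1 0 u p)
    {χ : ℝ → ℝ} (hχ : ContDiff ℝ ∞ χ) (hχc : HasCompactSupport χ) (hχI : tsupport χ ⊆ Ioo (-4 : ℝ) 0)
    (x c : EuclideanSpace ℝ (Fin 3)) :
    ∫ z in parabolicCylinder 2 (0 : ℝ × EuclideanSpace ℝ (Fin 3)),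
      (deriv χ z.1 * ⟪u z.1 z.2, ⟪gradient annularKernel (x - z.2), c⟫ • gradient kwonCutoff z.2 -
          cross (cross c (gradient annularKernel (x - z.2))) (gradient kwonCutoff z.2)⟫ +
        χ z.1 * (⟪u z.1 z.2, fderiv ℝ (fun y => ⟪gradient annularKernel (x - y), c⟫ • gradient kwonCutoff y -
            cross (cross c (gradient annularKernel (x - y))) (gradient kwonCutoff y)) z.2 (u z.1 z.2)⟫ +
          ⟪u z.1 z.2, Δ (fun y => ⟪gradient annularKernel (x - y), c⟫ • gradient kwonCutoff y -
            cross (cross c (gradient annularKernel (x - y))) (gradient kwonCutoff y)) z.2⟫ +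
          p z.1 z.2 * VectorCalculus.divergence (fun y => ⟪gradient annularKernel (x - y), c⟫ • gradient kwonCutoff y -
            cross (cross c (gradient annularKernel (x - y))) (gradient kwonCutoff y)) z.2)) = 0 := by
  set η : EuclideanSpace ℝ (Fin 3) → EuclideanSpace ℝ (Fin 3) := fun y =>
    ⟪gradient annularKernel (x - y), c⟫ • gradient kwonCutoff y -
      cross (cross c (gradient annularKernel (x - y))) (gradient kwonCutoff y) with hηdef
  have hη : ContDiff ℝ ∞ η := contDiff_adjointField x c
  have hη2 : ContDiff ℝ 2 η := contDiff_infty.1 hη 2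
  have hηd : ∀ y, DifferentiableAt ℝ η y := fun y => (hη.differentiable (by simp)) y
  have hχd : ∀ s, DifferentiableAt ℝ χ s := fun s => (hχ.differentiable (by simp)) s
  have hΨ : IsSpaceTimeTestOn (parabolicCylinderOpens 2 (0 : ℝ × EuclideanSpace ℝ (Fin 3)))
      (fun s y => χ s • η y) := isSpaceTimeTestOn_time_smul_adjointField hχ hχc hχI x c
  have key := hu.2.2.2.2 _ hΨ
  rw [coe_parabolicCylinderOpens] at key
  have e : ∀ z : ℝ × EuclideanSpace ℝ (Fin 3),
      ⟪u z.1 z.2, timeDeriv (fun s y => χ s • η y) z.1 z.2⟫ +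
        ⟪u z.1 z.2, convect (u z.1) (fun y => χ z.1 • η y) z.2⟫ +
        1 * ⟪u z.1 z.2, Δ (fun y => χ z.1 • η y) z.2⟫ +
        p z.1 z.2 * VectorCalculus.divergence (fun y => χ z.1 • η y) z.2 +
        ⟪(0 : ℝ → EuclideanSpace ℝ (Fin 3) → EuclideanSpace ℝ (Fin 3)) z.1 z.2, χ z.1 • η z.2⟫ =
      deriv χ z.1 * ⟪u z.1 z.2, η z.2⟫ +
        χ z.1 * (⟪u z.1 z.2, fderiv ℝ η z.2 (u z.1 z.2)⟫ + ⟪u z.1 z.2, Δ η z.2⟫ +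
          p z.1 z.2 * VectorCalculus.divergence η z.2) := by
    intro z
    have h1 : timeDeriv (fun s y => χ s • η y) z.1 z.2 = deriv χ z.1 • η z.2 := by
      rw [timeDeriv_apply]
      exact deriv_smul_const (hχd z.1) _
    have h2 : convect (u z.1) (fun y => χ z.1 • η y) z.2 = χ z.1 • fderiv ℝ η z.2 (u z.1 z.2) := by
      simp only [convect]
      rw [fderiv_fun_const_smul (hηd z.2) (χ z.1)]
      rfl
    have h3 : Δ (fun y => χ z.1 • η y) z.2 = χ z.1 • Δ η z.2 := laplacian_fun_const_smul hη2 (χ z.1) z.2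
    have h4 : VectorCalculus.divergence (fun y => χ z.1 • η y) z.2 = χ z.1 * VectorCalculus.divergence η z.2 :=
      divergence_fun_const_smul (hηd z.2) (χ z.1)
    rw [h1, h2, h3, h4]
    simp only [Pi.zero_apply, inner_zero_left, inner_smul_right, one_mul]
    ring
  have hQ : MeasurableSet (parabolicCylinder 2 (0 : ℝ × EuclideanSpace ℝ (Fin 3))) :=
    (isOpen_parabolicCylinder 2 _).measurableSet
  rw [← setIntegral_congr_fun hQ (fun z _ => e z)]
  exact key

end Kwon2023

end Literature.Analysis.FluidPDE

end
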